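import Summits.ResolutionOfSingularities.ResolutionOfSingularities.Theorems.WeightedInvariantJOpenPresentationPointStratum
import Summits.ResolutionOfSingularities.ResolutionOfSingularities.Theorems.WeightedInvariantTieFinitePrimesOver
import Summits.ResolutionOfSingularities.ResolutionOfSingularities.Theorems.WeightedInvariantTieFreeModelPackage
import Summits.ResolutionOfSingularities.ResolutionOfSingularities.Theorems.WeightedInvariantIota3EpsTopStratum
import Summits.ResolutionOfSingularities.ResolutionOfSingularities.Theorems.WeightedInvariantIota3Regimes
import Summits.ResolutionOfSingularities.ResolutionOfSingularities.Theorems.WeightedInvariantTieFiniteChartPrelims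
import HarnessLib

/-!
# (open″)≤3 for the pair of record `(ι₃ᵗ, J₃ᵗ)` — THE STRATUM IFF AT A TIE POINT: near a dimension-three TIE position (`τ = 1`)
# the value `ι₃ᵗ(𝔪)` is attained at `𝔪` only (door `HypersurfaceCentreConstruction`, stmt-ResolutionOfSingularities-19897; P3 rung
# clause h8 `JOpenPresentationForallSingLE 3 p Iota3.iotaFlatT Iota3.jFlatT`, ι-side of the point body (P₀₁) = (o52-Bτ);
# res-L1-w43-plan-1 RULING 2026-08-27T19:09:30Z «ι-sides: stub-3», hand res-L1-w43-stub-3; consumer res-D-pv-038's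
# `JOpenLE3.pointBodyLE3_zero_one_of`)

Topic: `Summits/ResolutionOfSingularities/ResolutionOfSingularities/Theorems`. Helper for the door item
`HypersurfaceCentreConstruction` (stmt-ResolutionOfSingularities-19897, route `WeightedInvariant`), line `local-engine`
(L W4.3), def-free.  **`exists_stratumIff_tie`**: `k` perfect, `A` of finite type, `𝔪` prime with `A_𝔪` regular of dimension `3`,
`0 ≠ F/1 ∈ 𝔪² A_𝔪`, `τ(A_𝔪, F/1) = 1` (a TIE position) ⇒ there is `h ∉ 𝔪` with, for every prime `𝔮 ∌ h` of local dimension `≤ 3`,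
`𝔪 ≤ 𝔮 ↔ (F ∈ 𝔪_{A_𝔮}² ∧ ι₃ᵗ(A_𝔮) F = ι₃ᵗ(A_𝔪) F)`.

ROUTE (the crossing-point argument of `…CrossingStratum` / `…PointStratum` with the centre moved to the tie curve).
`P₀ := topStratumPrime (ν;ε) (A_𝔪)` is a height-two prime (`TieFinite.IsTiePosition.ringKrullDim_localization_topStratumPrime_eq_two`),
`𝔭 := P₀ ∩ A`.  (1) res-type-073's `StratumIff.stratumIff_of_strat` with `v = (ν;ε)` and CENTRE `𝔭` — (c7) `iotaOrdEps_localization_mono`;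
ideal forms `{(ν;ε) ≥ (ν₀;0)} = V(I_{ν₀})`, `{(ν;ε) > (ν₀;0)} = V(I_{ν₀+1}·J)` (`husc_iotaOrd`, `exists_ideal_iotaEps_eq_one_iff`); the
(strat) input is the `(ν;ε)`-top stratum `V(P₀)` of `A_𝔪` (res-type-013's `topStratumPrime_iotaOrdEps_spec`) in `A`-form
(`StratumIff.strat_model_of_strat`) — gives `h₂` with `𝔭 ≤ 𝔮 ↔ (F ∈ 𝔪_𝔮² ∧ (ν;ε)(𝔮) = (ν;ε)(𝔪))` on `D(h₂)`.  (2) If moreover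
`τ(𝔮) = 1` and `dim A_𝔮 ≤ 3`, then `𝔮` is a tie position over `𝔭`, and by res-D-brk-1's `TieFinite.exists_modelPosition_package`
(on its `D(h₁)`) `𝔭 < 𝔮` with `(ν;ε)`-top-stratum prime `𝔭 A_𝔮` — so `𝔮` lies in the FINITE set of `TieFinite.finite_tiePrimes_over`
(p559175); `h₃` kills its members other than `𝔪` (none of them is `≤ 𝔪`: a tie prime has local dimension `3`).  (3)
`ι₃ᵗ(𝔮) = ι₃ᵗ(𝔪) ⇒ (ν;ε)(𝔮) = (ν;ε)(𝔪) ∧ τ(𝔮) = 1`; and `𝔪 ≤ 𝔮`, `dim A_𝔮 ≤ 3` ⇒ `𝔮 = 𝔪`.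

[OURS · L1 W4.3 · (o52-Bτ) ι-side]  Replaces the role of NO printed item; NOT a statement of the manuscript
[claim: Hironaka2017, status: under-review]. AI work, weaker than expert review.  Pure commutative algebra; no named facts.

## References

* V. Cossart, O. Piltant, J. Algebra 320 (2008), Prop. 4.2 (proof). [CossartPiltant2008]
* D. Abramovich, M. H. Quek, B. Schober, Thm 1.3 (3), Thm 3.5 (finiteness of the tie data along a curve). [AbramovichQuekSchober2025]
* H. Matsumura, *Commutative Ring Theory* (1987), §30 Cor. to Thm. 30.5, Thm. 13.5. [Matsumura1987]
-/

noncomputable section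

open IsLocalRing Literature.AlgebraicGeometry.Resolution
open Summit.ResolutionOfSingularities.ResolutionOfSingularities.Cruxes.HypersurfaceCentreConstruction.LocalEngine
open Summit.ResolutionOfSingularities.ResolutionOfSingularities.Cruxes.HypersurfaceCentreConstruction.LocalEngine.Iota3

set_option linter.dupNamespace false -- mandated namespace of this single-conjunct summit

namespace Summit.ResolutionOfSingularities.ResolutionOfSingularities.Theorems

namespace CrossingPoint

variable {A : Type} [CommRing A]

/-- **THE STRATUM IFF OF (open″)≤3 AT A TIE POINT.**  `k` perfect, `A` of finite type over `k`, `𝔪` a prime with `A_𝔪` regular of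
dimension `3`, `F ∈ A` with `0 ≠ F/1 ∈ 𝔪² A_𝔪` and `τ(A_𝔪, F/1) = 1`.  Then some basic open `D(h) ∋ 𝔪` has: for every prime
`𝔮 ∌ h` with `dim A_𝔮 ≤ 3`, `𝔪 ≤ 𝔮 ↔ (F/1 ∈ 𝔪_{A_𝔮}² ∧ ι₃ᵗ(A_𝔮)(F) = ι₃ᵗ(A_𝔪)(F))`. [OURS · L1 W4.3 · (o52-Bτ) ι-side]
[cite: AbramovichQuekSchober2025, Thm 1.3 (3)] -/
theorem exists_stratumIff_tie (k : Type) [Field k] [PerfectField k] [Algebra k A] [Algebra.FiniteType k A]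
    (𝔪 : Ideal A) [𝔪.IsPrime] (F : A) (hreg : IsRegularLocalRing (Localization.AtPrime 𝔪))
    (hdim : ringKrullDim (Localization.AtPrime 𝔪) = (3 : ℕ))
    (hF0 : algebraMap A (Localization.AtPrime 𝔪) F ≠ 0)
    (hF2 : algebraMap A (Localization.AtPrime 𝔪) F ∈ maximalIdeal (Localization.AtPrime 𝔪) ^ 2)
    (hτ : iotaTau (Localization.AtPrime 𝔪) (algebraMap A (Localization.AtPrime 𝔪) F) = 1) :
    ∃ h : A, h ∉ 𝔪 ∧ ∀ (𝔮 : Ideal A) [𝔮.IsPrime], h ∉ 𝔮 → ringKrullDim (Localization.AtPrime 𝔮) ≤ (3 : ℕ) →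
      (𝔪 ≤ 𝔮 ↔
        (algebraMap A (Localization.AtPrime 𝔮) F ∈ maximalIdeal (Localization.AtPrime 𝔮) ^ 2 ∧
          iotaFlatT (Localization.AtPrime 𝔮) (algebraMap A (Localization.AtPrime 𝔮) F) =
            iotaFlatT (Localization.AtPrime 𝔪) (algebraMap A (Localization.AtPrime 𝔪) F))) := by
  classical
  haveI : IsNoetherianRing A := Algebra.FiniteType.isNoetherianRing k A
  haveI := hreg
  have hdim' : ringKrullDim (Localization.AtPrime 𝔪) ≤ 3 := by rw [hdim]; exact le_of_eq (by norm_cast)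
  have hfm : algebraMap A (Localization.AtPrime 𝔪) F ∈ maximalIdeal (Localization.AtPrime 𝔪) :=
    Ideal.pow_le_self two_ne_zero hF2
  -- the tie position, its letters
  have htie : IsTiePosition (Localization.AtPrime 𝔪) (algebraMap A (Localization.AtPrime 𝔪) F) :=
    (iotaTau_eq_one_iff_isTiePosition hdim' _).mp hτ
  obtain ⟨_, -, hε, -, -⟩ := id htie
  obtain ⟨ν₀, hν₀⟩ := Ordinal.lt_omega0.mp (iotaOrd_lt_omega0_of_ne_zero (Localization.AtPrime 𝔪) hF0)
  -- the `(ν;ε)`-top stratum `V(P₀)` of `A_𝔪`, `P₀` of height two; `𝔭 := P₀ ∩ A`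
  obtain ⟨hP₀prime, -, hfP₀, hE, hkept, -⟩ := topStratumPrime_iotaOrdEps_spec hdim' hF0 hfm hν₀
  haveI := hP₀prime
  have hdimP₀ : ringKrullDim (Localization.AtPrime
      (ContactCylinder.topStratumPrime iotaOrdEps (Localization.AtPrime 𝔪) (algebraMap A (Localization.AtPrime 𝔪) F))) = 2 :=
    TieFinite.IsTiePosition.ringKrullDim_localization_topStratumPrime_eq_two htie
  set 𝔭 : Ideal A := (ContactCylinder.topStratumPrime iotaOrdEps (Localization.AtPrime 𝔪)
    (algebraMap A (Localization.AtPrime 𝔪) F)).comap (algebraMap A (Localization.AtPrime 𝔪)) with h𝔭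
  haveI : 𝔭.IsPrime := Ideal.IsPrime.comap _
  have h𝔪eq : Ideal.comap (algebraMap A (Localization.AtPrime 𝔪)) (maximalIdeal (Localization.AtPrime 𝔪)) = 𝔪 :=
    IsLocalization.AtPrime.under_maximalIdeal (Localization.AtPrime 𝔪) 𝔪
  have h𝔭𝔪 : 𝔭 ≤ 𝔪 := by
    rw [← h𝔪eq]
    exact Ideal.comap_mono (IsLocalRing.le_maximalIdeal hP₀prime.ne_top)
  have h𝔭map : 𝔭.map (algebraMap A (Localization.AtPrime 𝔪)) =
      ContactCylinder.topStratumPrime iotaOrdEps (Localization.AtPrime 𝔪) (algebraMap A (Localization.AtPrime 𝔪) F) := by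
    rw [h𝔭, ← Ideal.under_def]
    exact IsLocalization.map_under 𝔪.primeCompl (Localization.AtPrime 𝔪) _
  -- `A_𝔭 ≃ (A_𝔪)_{P₀}`, so `dim A_𝔭 = 2`
  let e₁ : Localization.AtPrime 𝔭 ≃+* Localization.AtPrime
      (ContactCylinder.topStratumPrime iotaOrdEps (Localization.AtPrime 𝔪) (algebraMap A (Localization.AtPrime 𝔪) F)) :=
    (IsLocalization.localizationLocalizationAtPrimeIsoLocalization 𝔪.primeCompl
      (ContactCylinder.topStratumPrime iotaOrdEps (Localization.AtPrime 𝔪) (algebraMap A (Localization.AtPrime 𝔪) F))).toRingEquiv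
  have hdim𝔭 : ringKrullDim (Localization.AtPrime 𝔭) = (2 : ℕ) := by
    rw [RingEquiv.ringKrullDim e₁, hdimP₀]; norm_cast
  -- the ORDER form of the stratum (`ε = 0`)
  have hEord : ContactCylinder.topStratum iotaOrd (Localization.AtPrime 𝔪) (algebraMap A (Localization.AtPrime 𝔪) F) =
      {𝔮 | 𝔭.map (algebraMap A (Localization.AtPrime 𝔪)) ≤ 𝔮.asIdeal} := by
    rw [← topStratum_iotaOrdEps_eq_topStratum_iotaOrd_of_iotaEps_eq_zero hfm hε, hE, h𝔭map]
  -- res-D-brk-1's model-position package: `A_𝔭` regular, `0 ≠ F/1 ∈ 𝔪²_{A_𝔭}`, and the tie primes over `𝔭` on `D(h₁)`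
  obtain ⟨hreg𝔭, hF0𝔭, hF2𝔭, h₁, hh₁, hpack⟩ :=
    TieFinite.exists_modelPosition_package k A 𝔪 F 𝔭 h𝔭𝔪 hF0 hF2 hdim𝔭 hEord
  haveI := hreg𝔭
  -- the finite set of tie primes over `𝔭`
  have hfin := TieFinite.finite_tiePrimes_over k A F 𝔭 hdim𝔭 hF0𝔭 hF2𝔭
  -- (1) the spectrum lemma with centre `𝔭`
  obtain ⟨h₀, hh₀, hreg₀⟩ := GenericEquimultiplicity.exists_not_mem_forall_isRegularLocalRing k 𝔪 hreg
  obtain ⟨I, hI⟩ := GenericEquimultiplicity.husc_iotaOrd k hreg₀ F ν₀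
  obtain ⟨I₁, hI₁⟩ := GenericEquimultiplicity.husc_iotaOrd k hreg₀ F (ν₀ + 1)
  obtain ⟨I₂, hI₂⟩ := GenericEquimultiplicity.husc_iotaOrd k hreg₀ F 2
  obtain ⟨J, hIJ, hJ⟩ := exists_ideal_iotaEps_eq_one_iff k hreg₀ F ν₀ hI
  have hlt_iff : ∀ (𝔮 : Ideal A) [𝔮.IsPrime], h₀ ∉ 𝔮 →
      ((ν₀ : Ordinal) < iotaOrd (Localization.AtPrime 𝔮) (algebraMap A (Localization.AtPrime 𝔮) F) ↔ I₁ ≤ 𝔮) := by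
    intro 𝔮 _ h𝔮
    rw [← hI₁ 𝔮 h𝔮, Nat.cast_succ, ← Order.succ_le_iff, Order.succ_eq_add_one]
  have hIJ_iff : ∀ (𝔮 : Ideal A) [𝔮.IsPrime], h₀ ∉ 𝔮 →
      (((ν₀ : Ordinal) < iotaOrd (Localization.AtPrime 𝔮) (algebraMap A (Localization.AtPrime 𝔮) F) ∨
        ((ν₀ : Ordinal) = iotaOrd (Localization.AtPrime 𝔮) (algebraMap A (Localization.AtPrime 𝔮) F) ∧
          iotaEps (Localization.AtPrime 𝔮) (algebraMap A (Localization.AtPrime 𝔮) F) = 1)) ↔ I₁ * J ≤ 𝔮) := by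
    intro 𝔮 _ h𝔮
    rw [Ideal.IsPrime.mul_le inferInstance, ← hlt_iff 𝔮 h𝔮]
    constructor
    · rintro (hlt | ⟨heq, hε1⟩)
      · exact Or.inl hlt
      · exact Or.inr ((hJ 𝔮 h𝔮 heq.symm).mp hε1)
    · rintro (hlt | hJ𝔮)
      · exact Or.inl hlt
      · have hν : (ν₀ : Ordinal) ≤ iotaOrd (Localization.AtPrime 𝔮) _ := (hI 𝔮 h𝔮).mpr (hIJ.trans hJ𝔮)
        rcases hν.lt_or_eq with hlt | heq
        · exact Or.inl hlt
        · exact Or.inr ⟨heq, (hJ 𝔮 h𝔮 heq.symm).mpr hJ𝔮⟩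
  obtain ⟨h₂, hh₂, hiff⟩ := StratumIff.stratumIff_of_strat
    (fun x : PrimeSpectrum A => iotaOrdEps (Localization.AtPrime x.asIdeal) (algebraMap A (Localization.AtPrime x.asIdeal) F))
    (fun x : PrimeSpectrum A =>
      algebraMap A (Localization.AtPrime x.asIdeal) F ∈ maximalIdeal (Localization.AtPrime x.asIdeal) ^ 2)
    ⟨𝔪, inferInstance⟩ h₀ hh₀
    (fun x y hy hxy => iotaOrdEps_localization_mono F x.asIdeal y.asIdeal hxy (hreg₀ _ hy))
    ⟨I, fun x hx => by
      change iotaOrdEps (Localization.AtPrime 𝔪) _ ≤ _ ↔ _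
      rw [iotaOrdEps_le_iff, hν₀, hε, ← hI x.asIdeal hx]
      constructor
      · rintro (hlt | ⟨heq, -⟩)
        · exact hlt.le
        · exact heq.le
      · intro hle
        rcases hle.lt_or_eq with hlt | heq
        · exact Or.inl hlt
        · exact Or.inr ⟨heq, zero_le⟩⟩
    ⟨I₁ * J, fun x hx => by
      change iotaOrdEps (Localization.AtPrime 𝔪) _ < _ ↔ _
      rw [show iotaOrdEps = iotaLex Ordinal.omega0 iotaOrd iotaEps from rfl, iotaLex_lt_iff iotaEps_boundedBy_omega0,
        hν₀, hε, ← hIJ_iff x.asIdeal hx]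
      constructor
      · rintro (hlt | ⟨heq, hlt0⟩)
        · exact Or.inl hlt
        · refine Or.inr ⟨heq, ?_⟩
          rcases iotaEps_eq_zero_or_eq_one (Localization.AtPrime x.asIdeal)
            (algebraMap A (Localization.AtPrime x.asIdeal) F) with h0 | h1
          · exact absurd h0 (ne_of_gt hlt0)
          · exact h1
      · rintro (hlt | ⟨heq, hε1⟩)
        · exact Or.inl hlt
        · exact Or.inr ⟨heq, by rw [hε1]; exact zero_lt_one⟩⟩
    ⟨I₂, fun x hx => by
      have h2 := hI₂ x.asIdeal hx
      rw [Nat.cast_ofNat] at h2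
      exact (StratumIff.mem_sq_iff_two_le_iotaOrd F x.asIdeal).trans h2⟩
    (fun x y hy hxy hx => by
      have hx' := (StratumIff.mem_sq_iff_two_le_iotaOrd F x.asIdeal).mp hx
      exact (StratumIff.mem_sq_iff_two_le_iotaOrd F y.asIdeal).mpr
        (hx'.trans (StratumIff.iotaOrd_localization_mono F _ _ hxy (hreg₀ _ hy))))
    ⟨𝔭, inferInstance⟩ h𝔭𝔪 hF2𝔭
    (fun x hx𝔪 hSgx => by
      have hFx : F ∈ x.asIdeal :=
        (IsLocalization.AtPrime.to_map_mem_maximal_iff (Localization.AtPrime x.asIdeal) x.asIdeal F).mp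
          (Ideal.pow_le_self two_ne_zero hSgx)
      exact StratumIff.strat_model_of_strat iotaOrdEps iotaOrdEps_isoInvariant 𝔪 F _ (fun Q _ hfQ => hkept Q hfQ)
        x.asIdeal hx𝔪 hFx)
  -- (2) an element killing the tie primes over `𝔭` other than `𝔪`
  have hsep : ∀ t ∈ hfin.toFinset, t.asIdeal ≠ 𝔪 → ∃ g : A, g ∈ t.asIdeal ∧ g ∉ 𝔪 := by
    intro t ht hne
    by_contra hcon
    have htle : t.asIdeal ≤ 𝔪 := fun g hg => by
      by_contra hg𝔪
      exact hcon ⟨g, hg, hg𝔪⟩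
    obtain ⟨-, -, htiet, -⟩ := hfin.mem_toFinset.mp ht
    have h3 : ringKrullDim (Localization.AtPrime t.asIdeal) = (3 : ℕ) := by
      rw [ringKrullDim_eq_three_of_isTiePosition htiet]; norm_cast
    exact hne (eq_of_le_of_ringKrullDim htle h3 hdim').symm
  choose! g hg using hsep
  have hh₃ : (∏ t ∈ hfin.toFinset.filter (fun t => t.asIdeal ≠ 𝔪), g t) ∉ 𝔪 := by
    intro hmem
    obtain ⟨t, ht, hgt⟩ := Ideal.IsPrime.prod_mem_iff.mp hmem
    obtain ⟨ht', hne⟩ := Finset.mem_filter.mp ht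
    exact (hg t ht' hne).2 hgt
  -- (3) assemble
  refine ⟨h₁ * h₂ * ∏ t ∈ hfin.toFinset.filter (fun t => t.asIdeal ≠ 𝔪), g t, fun hmem => ?_, fun 𝔮 _ hh𝔮 hdim𝔮 => ?_⟩
  · rcases Ideal.IsPrime.mem_or_mem inferInstance hmem with h12 | h3
    · rcases Ideal.IsPrime.mem_or_mem inferInstance h12 with hm1 | hm2
      · exact hh₁ hm1
      · exact hh₂ hm2
    · exact hh₃ h3
  have hh₁𝔮 : h₁ ∉ 𝔮 := fun h => hh𝔮 (Ideal.mul_mem_right _ _ (Ideal.mul_mem_right _ _ h))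
  have hh₂𝔮 : h₂ ∉ 𝔮 := fun h => hh𝔮 (Ideal.mul_mem_right _ _ (Ideal.mul_mem_left _ _ h))
  have hh₃𝔮 : (∏ t ∈ hfin.toFinset.filter (fun t => t.asIdeal ≠ 𝔪), g t) ∉ 𝔮 := fun h => hh𝔮 (Ideal.mul_mem_left _ _ h)
  have hdim𝔮' : ringKrullDim (Localization.AtPrime 𝔮) ≤ 3 := hdim𝔮.trans (le_of_eq (by norm_cast))
  constructor
  · intro hle
    have heq : 𝔮 = 𝔪 := eq_of_le_of_ringKrullDim hle hdim hdim𝔮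
    subst heq
    exact ⟨hF2, rfl⟩
  · rintro ⟨hSg, hflat⟩
    have h1 := ((iotaFlatT_eq_iff _ _ _ _).mp hflat).1
    obtain ⟨hνε, hτ𝔮⟩ := (iotaOrdEpsTau_eq_iff _ _ _ _).mp h1
    -- `𝔭 ≤ 𝔮` from the spectrum lemma
    have h𝔭𝔮 : 𝔭 ≤ 𝔮 := (hiff ⟨𝔮, inferInstance⟩ hh₂𝔮).mpr ⟨hSg, hνε⟩
    -- `𝔮` is a tie position over `𝔭`
    have htie𝔮 : IsTiePosition (Localization.AtPrime 𝔮) (algebraMap A (Localization.AtPrime 𝔮) F) :=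
      (iotaTau_eq_one_iff_isTiePosition hdim𝔮' _).mp (hτ𝔮.trans hτ)
    obtain ⟨hlt, htop𝔮⟩ := hpack 𝔮 hh₁𝔮 h𝔭𝔮 htie𝔮
    have hmemT : (⟨𝔮, inferInstance⟩ : PrimeSpectrum A) ∈ hfin.toFinset :=
      hfin.mem_toFinset.mpr ⟨hlt, hdim𝔮, htie𝔮, htop𝔮⟩
    -- hence `𝔮 = 𝔪`
    by_contra h𝔪𝔮
    have hne : 𝔮 ≠ 𝔪 := fun heq => h𝔪𝔮 heq.symm.le
    have hmemf : (⟨𝔮, inferInstance⟩ : PrimeSpectrum A) ∈ hfin.toFinset.filter (fun t => t.asIdeal ≠ 𝔪) :=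
      Finset.mem_filter.mpr ⟨hmemT, hne⟩
    apply hh₃𝔮
    rw [← Finset.prod_erase_mul _ _ hmemf]
    exact Ideal.mul_mem_left _ _ (hg _ hmemT hne).1

end CrossingPoint

end Summit.ResolutionOfSingularities.ResolutionOfSingularities.Theorems

end
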